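import Mathlib
import Summits.Ventures.PercRepro2.HCov
import Summits.Ventures.PercRepro2.GcRational
import Summits.Ventures.PercRepro2.GcHalf

/-!
# The crux as an integer statement: `Gc` at `p ≡ ½` is a cubic form in configuration counts
(blind cell PercRepro2, typer-1 g58)

`GcHalf.lean` put the crux at the uniform weight ½ on multigraphs. At ½ every mass is a COUNT of
configurations over `2^|E|` (`Half.prob_half`), and `Gc` is a cubic form in its masses, so
`2^{3|E|} · Gc` is an INTEGER cubic form in the counts:

* **`Count.GcOf μ`** — the cubic form of `Gc` with an arbitrary set function `μ` in place of
  `prob p` (the twelve named masses mirrored: `EQboOf μ`, …); `Gc p ends … = GcOf (prob p) ends …`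
  by `rfl` (**`Gc_eq_GcOf`**); **`GcOf_smul`**: `GcOf (c • μ) = c³ · GcOf μ`; **`GcOf_map`**: a
  ring homomorphism carries `GcOf`;
* **`Count.cnt A = |A|`** (the number of configurations in the event) and
  **`Count.GcZ ends o a₁ a₂ a₃ b = GcOf cnt … : ℤ`** — THE INTEGER FORM OF THE COVARIANCE FORM;
* **`Gc_half_eq_GcZ`**: `Gc (½) ends … = GcZ ends … / 2^{3|E|}` over `ℚ`, hence
  **`HCov_half_iff_GcZ_nonneg`**: (HCOV) at ½ is `0 ≤ GcZ`;
* **`HCovZ_all`** — `0 ≤ GcZ` on every finite multigraph with five distinct marks — and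
  **`HCov_all_real_iff_Z`**: `HCov_all ℝ ↔ HCovZ_all`: THE CRUX IS THE NON-NEGATIVITY OF ONE
  INTEGER CUBIC FORM IN THIRTY CONFIGURATION COUNTS ON EVERY FINITE MULTIGRAPH — no weights, no
  rationals, no real numbers.

Standard axioms.
-/

namespace Summit.Ventures.PercRepro2

open CovForm

namespace Count

/-! ## The cubic form with an arbitrary set function -/

section Form

variable {V : Type*} {E : Type*} {R : Type*} [CommRing R]

/-- `EQbo` with the set function `μ`. -/
def EQboOf (μ : Set (Config E) → R) (ends : E → Sym2 V) (o a₁ a₂ b : V) : R :=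
  μ (avoidAll ends a₂ {a₁} ∩ (connEvent ends a₁ o ∩ connEvent ends a₁ b)) +
    μ (avoidAll ends a₂ {a₁} ∩ (connEvent ends a₂ o ∩ connEvent ends a₂ b)) -
    μ (avoidAll ends a₂ {a₁} ∩ (connEvent ends a₂ o ∩ connEvent ends a₁ b)) -
    μ (avoidAll ends a₂ {a₁} ∩ (connEvent ends a₁ o ∩ connEvent ends a₂ b))

/-- `EQb3` with the set function `μ`. -/
def EQb3Of (μ : Set (Config E) → R) (ends : E → Sym2 V) (a₁ a₂ a₃ b : V) : R :=
  μ (TEvent ends a₂ a₁ a₃ ∩ connEvent ends a₁ b) +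
    μ (TEvent ends a₁ a₂ a₃ ∩ connEvent ends a₂ b) -
    μ (TEvent ends a₁ a₂ a₃ ∩ connEvent ends a₁ b) -
    μ (TEvent ends a₂ a₁ a₃ ∩ connEvent ends a₂ b)

/-- `EQb3o` with the set function `μ`. -/
def EQb3oOf (μ : Set (Config E) → R) (ends : E → Sym2 V) (o a₁ a₂ a₃ b : V) : R :=
  μ (TEvent ends a₂ a₁ a₃ ∩ (connEvent ends a₁ o ∩ connEvent ends a₁ b)) +
    μ (TEvent ends a₂ a₁ a₃ ∩ (connEvent ends a₂ o ∩ connEvent ends a₁ b)) +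
    μ (TEvent ends a₁ a₂ a₃ ∩ (connEvent ends a₁ o ∩ connEvent ends a₂ b)) +
    μ (TEvent ends a₁ a₂ a₃ ∩ (connEvent ends a₂ o ∩ connEvent ends a₂ b)) -
    μ (TEvent ends a₁ a₂ a₃ ∩ (connEvent ends a₁ o ∩ connEvent ends a₁ b)) -
    μ (TEvent ends a₁ a₂ a₃ ∩ (connEvent ends a₂ o ∩ connEvent ends a₁ b)) -
    μ (TEvent ends a₂ a₁ a₃ ∩ (connEvent ends a₁ o ∩ connEvent ends a₂ b)) -
    μ (TEvent ends a₂ a₁ a₃ ∩ (connEvent ends a₂ o ∩ connEvent ends a₂ b))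

/-- `EQo` with the set function `μ`. -/
def EQoOf (μ : Set (Config E) → R) (ends : E → Sym2 V) (o a₁ a₂ : V) : R :=
  μ (avoidAll ends a₂ {a₁} ∩ connEvent ends a₁ o) - μ (avoidAll ends a₂ {a₁} ∩ connEvent ends a₂ o)

/-- `EQ3` with the set function `μ`. -/
def EQ3Of (μ : Set (Config E) → R) (ends : E → Sym2 V) (a₁ a₂ a₃ : V) : R :=
  μ (TEvent ends a₂ a₁ a₃) - μ (TEvent ends a₁ a₂ a₃)

/-- `EQ3o` with the set function `μ`. -/
def EQ3oOf (μ : Set (Config E) → R) (ends : E → Sym2 V) (o a₁ a₂ a₃ : V) : R :=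
  μ (TEvent ends a₂ a₁ a₃ ∩ connEvent ends a₁ o) +
    μ (TEvent ends a₂ a₁ a₃ ∩ connEvent ends a₂ o) -
    μ (TEvent ends a₁ a₂ a₃ ∩ connEvent ends a₁ o) -
    μ (TEvent ends a₁ a₂ a₃ ∩ connEvent ends a₂ o)

/-- `PDb` with the set function `μ`. -/
def PDbOf (μ : Set (Config E) → R) (ends : E → Sym2 V) (a₁ a₂ a₃ b : V) : R :=
  μ (PDEvent ends a₁ a₂ a₃ ∩ connEvent ends a₁ b) + μ (PDEvent ends a₁ a₂ a₃ ∩ connEvent ends a₂ b)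

/-- `PDbo` with the set function `μ`. -/
def PDboOf (μ : Set (Config E) → R) (ends : E → Sym2 V) (o a₁ a₂ a₃ b : V) : R :=
  μ (PDEvent ends a₁ a₂ a₃ ∩ (connEvent ends a₁ o ∩ connEvent ends a₁ b)) +
    μ (PDEvent ends a₁ a₂ a₃ ∩ (connEvent ends a₂ o ∩ connEvent ends a₁ b)) +
    μ (PDEvent ends a₁ a₂ a₃ ∩ (connEvent ends a₁ o ∩ connEvent ends a₂ b)) +
    μ (PDEvent ends a₁ a₂ a₃ ∩ (connEvent ends a₂ o ∩ connEvent ends a₂ b))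

/-- `Do` with the set function `μ`. -/
def DoOf (μ : Set (Config E) → R) (ends : E → Sym2 V) (o a₁ a₂ a₃ : V) : R :=
  μ (PDEvent ends a₁ a₂ a₃ ∩ connEvent ends a₁ o) + μ (PDEvent ends a₁ a₂ a₃ ∩ connEvent ends a₂ o)

/-- `gap` with the set function `μ`. -/
def gapOf (μ : Set (Config E) → R) (ends : E → Sym2 V) (a₁ a₂ b : V) : R :=
  μ (connEvent ends a₂ b) - μ (connEvent ends a₁ b)

/-- `DEF` with the set function `μ`. -/
def DEFOf (μ : Set (Config E) → R) (ends : E → Sym2 V) (o a₁ a₂ a₃ : V) : R :=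
  μ (PDEvent ends a₁ a₂ a₃) * EQoOf μ ends o a₁ a₂ + DoOf μ ends o a₁ a₂ a₃ * EQ3Of μ ends a₁ a₂ a₃ -
    μ (PDEvent ends a₁ a₂ a₃) * EQ3oOf μ ends o a₁ a₂ a₃

/-- **The cubic form of `Gc`** with the set function `μ` in place of `prob p`. -/
def GcOf (μ : Set (Config E) → R) (ends : E → Sym2 V) (o a₁ a₂ a₃ b : V) : R :=
  μ (avoidAll ends a₂ {a₁}) *
      (μ (PDEvent ends a₁ a₂ a₃) * EQboOf μ ends o a₁ a₂ b +
        DoOf μ ends o a₁ a₂ a₃ * EQb3Of μ ends a₁ a₂ a₃ b -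
        μ (PDEvent ends a₁ a₂ a₃) * EQb3oOf μ ends o a₁ a₂ a₃ b) +
    gapOf μ ends a₁ a₂ b * DEFOf μ ends o a₁ a₂ a₃ +
    μ (avoidAll ends a₂ {a₁}) *
      (DoOf μ ends o a₁ a₂ a₃ * PDbOf μ ends a₁ a₂ a₃ b -
        μ (PDEvent ends a₁ a₂ a₃) * PDboOf μ ends o a₁ a₂ a₃ b)

/-- **Homogeneity**: `GcOf (c • μ) = c³ · GcOf μ`. -/
lemma GcOf_smul (c : R) (μ : Set (Config E) → R) (ends : E → Sym2 V) (o a₁ a₂ a₃ b : V) :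
    GcOf (fun A => c * μ A) ends o a₁ a₂ a₃ b = c ^ 3 * GcOf μ ends o a₁ a₂ a₃ b := by
  simp only [GcOf, DEFOf, EQboOf, EQb3Of, EQb3oOf, EQoOf, EQ3Of, EQ3oOf, PDbOf, PDboOf, DoOf,
    gapOf]
  ring

/-- A ring homomorphism carries the cubic form. -/
lemma GcOf_map {S : Type*} [CommRing S] (f : R →+* S) (μ : Set (Config E) → R)
    (ends : E → Sym2 V) (o a₁ a₂ a₃ b : V) :
    f (GcOf μ ends o a₁ a₂ a₃ b) = GcOf (fun A => f (μ A)) ends o a₁ a₂ a₃ b := by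
  simp only [GcOf, DEFOf, EQboOf, EQb3Of, EQb3oOf, EQoOf, EQ3Of, EQ3oOf, PDbOf, PDboOf, DoOf,
    gapOf, map_add, map_sub, map_mul]

end Form

/-! ## `Gc` is the form at `prob p` -/

section Prob

variable {V : Type*} {E : Type*} [Fintype E] [DecidableEq E] {R : Type*} [Field R]

/-- `Gc p` is the cubic form at `μ = prob p`. -/
lemma Gc_eq_GcOf (p : E → R) (ends : E → Sym2 V) (o a₁ a₂ a₃ b : V) :
    Gc p ends o a₁ a₂ a₃ b = GcOf (prob p) ends o a₁ a₂ a₃ b := rfl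

end Prob

/-! ## Counts and the integer form -/

section Counts

variable {V : Type*} {E : Type*} [Fintype E] [DecidableEq E]

open Classical in
/-- The number of configurations in the event `A`. -/
noncomputable def cnt (A : Set (Config E)) : ℕ := (Finset.univ.filter (· ∈ A)).card

/-- **The integer form of the covariance form**: the cubic form of `Gc` evaluated at the
configuration counts. -/
noncomputable def GcZ (ends : E → Sym2 V) (o a₁ a₂ a₃ b : V) : ℤ :=
  GcOf (fun A => (cnt A : ℤ)) ends o a₁ a₂ a₃ b

open Classical in
/-- At `p ≡ ½` the masses are the counts over `2^|E|`. -/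
lemma prob_half_eq_cnt :
    prob (fun _ : E => (1 / 2 : ℚ)) =
      fun A : Set (Config E) => (1 / 2 ^ Fintype.card E : ℚ) * ((cnt A : ℤ) : ℚ) := by
  funext A
  rw [Half.prob_half, cnt]
  push_cast
  ring

/-- **`Gc` at ½ is the integer form over `2^{3|E|}`**. -/
theorem Gc_half_eq_GcZ (ends : E → Sym2 V) (o a₁ a₂ a₃ b : V) :
    Gc (fun _ : E => (1 / 2 : ℚ)) ends o a₁ a₂ a₃ b =
      (GcZ ends o a₁ a₂ a₃ b : ℚ) / 2 ^ (3 * Fintype.card E) := by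
  rw [Gc_eq_GcOf, prob_half_eq_cnt, GcOf_smul, GcZ, ← eq_intCast (Int.castRingHom ℚ), GcOf_map]
  simp only [eq_intCast]
  have h8 : ((1 : ℚ) / 2 ^ Fintype.card E) ^ 3 = 1 / 2 ^ (3 * Fintype.card E) := by
    rw [one_div, one_div, inv_pow, ← pow_mul, mul_comm (Fintype.card E) 3]
  rw [h8]
  ring

/-- **(HCOV) at ½ is the non-negativity of the integer form.** -/
theorem HCov_half_iff_GcZ_nonneg (ends : E → Sym2 V) (o a₁ a₂ a₃ b : V) :
    HCov (fun _ : E => (1 / 2 : ℚ)) ends o a₁ a₂ a₃ b ↔ 0 ≤ GcZ ends o a₁ a₂ a₃ b := by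
  unfold HCov
  rw [Gc_half_eq_GcZ, le_div_iff₀ (by positivity), zero_mul]
  exact ⟨fun h => by exact_mod_cast h, fun h => by exact_mod_cast h⟩

end Counts

/-! ## The statement of record -/

section Main

/-- **The integer crux**: `0 ≤ GcZ` on every finite multigraph with five distinct marks. -/
def HCovZ_all : Prop :=
  ∀ (V E : Type) [Fintype V] [DecidableEq V] [Fintype E] [DecidableEq E] (ends : E → Sym2 V),
    ∀ o a₁ a₂ a₃ b : V, a₁ ≠ a₂ → a₁ ≠ a₃ → a₂ ≠ a₃ → o ≠ a₁ → o ≠ a₂ → o ≠ a₃ → o ≠ b →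
      b ≠ a₁ → b ≠ a₂ → b ≠ a₃ → 0 ≤ GcZ ends o a₁ a₂ a₃ b

/-- (HCOV) at ½ over `ℚ` is the integer crux. -/
theorem half_rat_iff_Z : Half.HCov_half_all ℚ ↔ HCovZ_all := by
  constructor
  · intro h V E _ _ _ _ ends o a₁ a₂ a₃ b h12 h13 h23 ho1 ho2 ho3 hob hb1 hb2 hb3
    exact (HCov_half_iff_GcZ_nonneg ends o a₁ a₂ a₃ b).1
      (h V E ends o a₁ a₂ a₃ b h12 h13 h23 ho1 ho2 ho3 hob hb1 hb2 hb3)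
  · intro h V E _ _ _ _ ends o a₁ a₂ a₃ b h12 h13 h23 ho1 ho2 ho3 hob hb1 hb2 hb3
    exact (HCov_half_iff_GcZ_nonneg ends o a₁ a₂ a₃ b).2
      (h V E ends o a₁ a₂ a₃ b h12 h13 h23 ho1 ho2 ho3 hob hb1 hb2 hb3)

/-- **THE CRUX IS AN INTEGER STATEMENT**: `HCov_all ℝ ↔ HCovZ_all` — the non-negativity of one
integer cubic form in thirty configuration counts on every finite multigraph with five distinct
marks. -/
theorem HCov_all_real_iff_Z : HCov_all ℝ ↔ HCovZ_all :=
  Half.HCov_all_real_iff_half_rat.trans half_rat_iff_Z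

end Main

end Count

end Summit.Ventures.PercRepro2
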